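import Literature.AnabelianGeometry.EtaleTheta.Setting
import Literature.AnabelianGeometry.SemiGraphs.TemperedProfiniteProducts
import HarnessLib

/-!
# [EtTh] §1 root interface: the product of a theta setting with a finite discrete abelian group is again a
# theta setting (construction; used to certify that the guard `IsEtThOrigin` is NOT derivable from the root)

Mochizuki, *The étale theta function …*, Publ. RIMS **45** (2009) [EtTh], §1, PRIMS PDF pp. 11–15, 17
[cite: MochizukiEtTh2009, §1 p.12]; Mochizuki, *Semi-graphs of anabelioids*, Publ. RIMS **42** (2006) [SemiAnbd],
§6 p. 69 (`Π^tp_X ⊆ Π_X`), p. 71 (decomposition groups) [cite: MochizukiSemiAnbd2006, §6 p.69].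

abc-iut cell, block F fact-proving wave, seat abc-iut-f-132 (FACT-LIST row F-2498 `ThetaSetting.IsEtThOrigin`, the
vacuity guard "`Δ_X` is a profinite free group on 2 generators" of the L2 root `ThetaSetting p`, `Setting.lean`):
to certify that the guard is NOT derivable from the root interface one needs a SECOND inhabitant of the root whose
`Δ_X` is not free; it is obtained from any inhabitant by a finite abelian factor.  CONSTRUCTION FILE (new path;
nothing frozen is edited or restated; no instance, no named fact):
* `SemiGraphs.ProdDiscrete.*` — subgroup bookkeeping for `G × A` (kernels / images / intersections / relative
  indices / closures of `H × ⊤`, `H × 1`);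
* `SemiGraphs.TemperedCurve.prodDiscrete X A` — the [SemiAnbd] §6 tempered-curve datum `Π^tp ↦ Π^tp × A`,
  `Π ↦ Π × A` for a FINITE discrete abelian group `A` (augmentations through the first projection, decomposition
  groups `D_x × 1`; `Π^tp × A → Π × A` is a profinite completion by abc-iut-w5-d240's
  `IsProfiniteCompletion.prodMap_id`), with `Δ^tp ↦ Δ^tp × A`, `Δ ↦ Δ × A` (`deltaHat_prodDiscrete`);
* `ThetaSetting.prodDiscrete D A` — the [EtTh] §1 root datum `D ↦ D × A`: `(Π^tp_X)^Θ × A`, `(Π^tp_X)^ell × A`,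
  `Π^tp_{Y_N} × A`, `Π^tp_{Z_N} × A`, same `K`, `q_X`, `q̈`, `Π^tp_X ↠ Z` through the first projection; every printed
  kernel / index / normality / openness clause of the root transfers (the commutator closures of `Δ_X × A` are
  those of `Δ_X` times `1`, `A` being abelian — `comap_closure_commutator_prod`); `ThetaSetting.deltaHat_prodDiscrete`
  (its `Δ_X` is `Δ_X × A`), `deltaTheta_prodDiscrete` (its `Δ_Θ` is `Δ_Θ × 1`).
The companion proof file `SettingGuardIndependence.lean` shows that for `A = ℤ/2` and `D` satisfying the guard,
`Δ_X × ℤ/2` is NOT free profinite on two generators: the root interface does not imply its guard.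

HONEST FRAMING: a synthetic closure property of OUR typed interfaces (consistency / independence evidence only);
`Π^tp × A` is not the tempered fundamental group of a curve; nothing of [SemiAnbd]/[EtTh] is asserted; no side
taken on [IUTchIII] Cor. 3.12.
-/

noncomputable section


open scoped Pointwise

namespace Literature.AnabelianGeometry.SemiGraphs

open Topology

/-! ### Subgroup bookkeeping for products with a second factor -/

namespace ProdDiscrete

variable {G : Type*} [Group G] {A : Type*} [Group A]

/-- `Ker(f ∘ pr₁) = Ker(f) × A`. (bookkeeping for the product datum `Π^tp × A`). [cite: MochizukiSemiAnbd2006, §6 p.69] -/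
theorem ker_comp_fst {N : Type*} [Group N] (f : G →* N) :
    (f.comp (MonoidHom.fst G A)).ker = f.ker.prod ⊤ := by
  ext x
  simp [MonoidHom.mem_ker, Subgroup.mem_prod]

/-- `(H × K) ⊓ (H' × K') = (H ⊓ H') × (K ⊓ K')`. (bookkeeping for the product datum `Π^tp × A`). [cite: MochizukiSemiAnbd2006, §6 p.69] -/
theorem prod_inf_prod (H H' : Subgroup G) (K K' : Subgroup A) :
    H.prod K ⊓ H'.prod K' = (H ⊓ H').prod (K ⊓ K') := by
  ext x
  simp only [Subgroup.mem_inf, Subgroup.mem_prod]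
  tauto

/-- `(f × g)(H × K) = f(H) × g(K)`. (bookkeeping for the product datum `Π^tp × A`). [cite: MochizukiSemiAnbd2006, §6 p.69] -/
theorem map_prodMap_prod {N : Type*} [Group N] {B : Type*} [Group B] (f : G →* N) (g : A →* B)
    (H : Subgroup G) (K : Subgroup A) : (H.prod K).map (f.prodMap g) = (H.map f).prod (K.map g) := by
  ext x
  constructor
  · rintro ⟨y, hy, rfl⟩
    exact ⟨⟨y.1, (Subgroup.mem_prod.mp hy).1, rfl⟩, ⟨y.2, (Subgroup.mem_prod.mp hy).2, rfl⟩⟩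
  · rintro ⟨⟨y₁, hy₁, h₁⟩, ⟨y₂, hy₂, h₂⟩⟩
    exact ⟨(y₁, y₂), Subgroup.mem_prod.mpr ⟨hy₁, hy₂⟩, Prod.ext h₁ h₂⟩

/-- `(f ∘ pr₁)(H × K) = f(H)`. (bookkeeping for the product datum `Π^tp × A`). [cite: MochizukiSemiAnbd2006, §6 p.69] -/
theorem map_comp_fst_prod {N : Type*} [Group N] (f : G →* N) (H : Subgroup G) (K : Subgroup A) :
    (H.prod K).map (f.comp (MonoidHom.fst G A)) = H.map f := by
  ext x
  constructor
  · rintro ⟨y, hy, rfl⟩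
    exact ⟨y.1, (Subgroup.mem_prod.mp hy).1, rfl⟩
  · rintro ⟨y, hy, rfl⟩
    exact ⟨(y, 1), Subgroup.mem_prod.mpr ⟨hy, one_mem K⟩, rfl⟩

/-- `pr₁ '' (H × K) = H` (as sets, through any map `f` after `pr₁`). (bookkeeping for the product datum `Π^tp × A`). [cite: MochizukiSemiAnbd2006, §6 p.69] -/
theorem image_comp_fst_prod {N : Type*} (f : G → N) (H : Subgroup G) (K : Subgroup A) :
    (fun x : G × A => f x.1) '' (H.prod K : Set (G × A)) = f '' H := by
  ext y
  constructor
  · rintro ⟨x, hx, rfl⟩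
    exact ⟨x.1, (Subgroup.mem_prod.mp hx).1, rfl⟩
  · rintro ⟨x, hx, rfl⟩
    exact ⟨(x, 1), Subgroup.mem_prod.mpr ⟨hx, one_mem K⟩, rfl⟩

/-- `[H × ⊤ : K × ⊤] = [H : K]`. (bookkeeping for the product datum `Π^tp × A`). [cite: MochizukiSemiAnbd2006, §6 p.69] -/
theorem relIndex_prod_top (H K : Subgroup G) :
    (H.prod (⊤ : Subgroup A)).relIndex (K.prod ⊤) = H.relIndex K := by
  have hK : (K.prod (⊤ : Subgroup A)).map (MonoidHom.fst G A) = K := by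
    ext x
    constructor
    · rintro ⟨y, hy, rfl⟩
      exact (Subgroup.mem_prod.mp hy).1
    · intro hx
      exact ⟨(x, 1), Subgroup.mem_prod.mpr ⟨hx, Subgroup.mem_top _⟩, rfl⟩
  rw [Subgroup.prod_top H, Subgroup.relIndex_comap, hK]

/-- The topological closure of `H × ⊤` is `H⁻ × ⊤`. (bookkeeping for the product datum `Π^tp × A`). [cite: MochizukiSemiAnbd2006, §6 p.69] -/
theorem topologicalClosure_prod_top [TopologicalSpace G] [IsTopologicalGroup G] [TopologicalSpace A]
    [IsTopologicalGroup A] (H : Subgroup G) :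
    (H.prod (⊤ : Subgroup A)).topologicalClosure = H.topologicalClosure.prod ⊤ := by
  apply SetLike.coe_injective
  rw [Subgroup.topologicalClosure_coe, Subgroup.coe_prod, Subgroup.coe_prod, Subgroup.topologicalClosure_coe,
    Subgroup.coe_top, closure_prod_eq, closure_univ]

/-- The topological closure of `H × 1` is `H⁻ × 1` (`A` Hausdorff). (bookkeeping for the product datum `Π^tp × A`). [cite: MochizukiSemiAnbd2006, §6 p.69] -/
theorem topologicalClosure_prod_bot [TopologicalSpace G] [IsTopologicalGroup G] [TopologicalSpace A]
    [IsTopologicalGroup A] [T1Space A] (H : Subgroup G) :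
    (H.prod (⊥ : Subgroup A)).topologicalClosure = H.topologicalClosure.prod ⊥ := by
  apply SetLike.coe_injective
  rw [Subgroup.topologicalClosure_coe, Subgroup.coe_prod, Subgroup.coe_prod, Subgroup.topologicalClosure_coe,
    Subgroup.coe_bot, closure_prod_eq, closure_singleton]

end ProdDiscrete

/-! ### The tempered-curve interface is closed under a finite discrete abelian factor -/

namespace TemperedCurve

open ProdDiscrete

variable {p : ℕ} [Fact p.Prime] (X : TemperedCurve p) (A : Type) [CommGroup A] [Finite A] [TopologicalSpace A]
  [DiscreteTopology A]

/-- The inertia subgroup of `D_x × 1` inside `Π^tp × A` is `(D_x ∩ Δ^tp) × 1`, homeomorphically-isomorphic to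
`D_x ∩ Δ^tp`. [cite: MochizukiSemiAnbd2006, §6 p.71] -/
def inertiaProdEquiv (x : X.Pt) :
    ↥((X.decomp x).prod (⊥ : Subgroup A) ⊓
        ((X.aug.comp (ContinuousMonoidHom.fst X.PiTemp A)).toMonoidHom).ker) ≃ₜ*
      ↥(X.decomp x ⊓ X.aug.toMonoidHom.ker) where
  toFun g := ⟨g.1.1, ⟨(Subgroup.mem_prod.mp g.2.1).1, g.2.2⟩⟩
  invFun h := ⟨(h.1, 1), ⟨Subgroup.mem_prod.mpr ⟨h.2.1, one_mem _⟩, h.2.2⟩⟩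
  left_inv g := by
    apply Subtype.ext
    apply Prod.ext
    · rfl
    · exact ((Subgroup.mem_bot.mp (Subgroup.mem_prod.mp g.2.1).2)).symm
  right_inv h := rfl
  map_mul' g h := rfl
  continuous_toFun := by
    apply Continuous.subtype_mk
    exact continuous_fst.comp continuous_subtype_val
  continuous_invFun := by
    apply Continuous.subtype_mk
    exact continuous_subtype_val.prodMk continuous_const

/-- **`Π^tp ↦ Π^tp × A` on the [SemiAnbd] §6 tempered-curve interface** (`A` finite discrete abelian): same
base field; augmentation and profinite augmentation through the first projection; `Π := Π × A` with
`Π^tp × A → Π × A` the product of the completion map with the identity (a profinite completion,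
abc-iut-w5-d240's `IsProfiniteCompletion.prodMap_id`, `TemperedProfiniteProducts.lean`); closed points and cusps unchanged with decomposition groups `D_x × 1` (so
the inertia clauses transfer verbatim). [cite: MochizukiSemiAnbd2006, §6 p.69] -/
abbrev prodDiscrete : TemperedCurve p where
  K := X.K
  finiteDimensional_K := X.finiteDimensional_K
  PiTemp := X.PiTemp × A
  aug := X.aug.comp (ContinuousMonoidHom.fst X.PiTemp A)
  range_aug := by
    rw [← X.range_aug]
    show (X.aug.toMonoidHom.comp (MonoidHom.fst X.PiTemp A)).range = _
    rw [MonoidHom.range_comp, MonoidHom.range_eq_top.mpr Prod.fst_surjective, ← MonoidHom.range_eq_map]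
  PiHat := X.PiHat × A
  toHat := X.toHat.prodMap (ContinuousMonoidHom.id A)
  isProfiniteCompletion_toHat := X.isProfiniteCompletion_toHat.prodMap_id
  toHat_injective := X.toHat_injective.prodMap Function.injective_id
  augHat := X.augHat.comp (ContinuousMonoidHom.fst X.PiHat A)
  augHat_comp g := X.augHat_comp g.1
  Pt := X.Pt
  IsCusp := X.IsCusp
  decomp x := (X.decomp x).prod ⊥
  isClosed_decomp x := by
    rw [Subgroup.coe_prod, Subgroup.coe_bot]
    exact (X.isClosed_decomp x).prod isClosed_singleton
  isOpen_aug_decomp x := by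
    have h : ((X.aug.comp (ContinuousMonoidHom.fst X.PiTemp A)) : X.PiTemp × A → GQp p) ''
        ((X.decomp x).prod (⊥ : Subgroup A) : Set (X.PiTemp × A)) = X.aug '' (X.decomp x) :=
      image_comp_fst_prod X.aug (X.decomp x) ⊥
    rw [h]
    exact X.isOpen_aug_decomp x
  inertia_eq_bot x hx := by
    show (X.decomp x).prod (⊥ : Subgroup A) ⊓ (X.aug.toMonoidHom.comp (MonoidHom.fst X.PiTemp A)).ker = ⊥
    rw [ker_comp_fst, prod_inf_prod, X.inertia_eq_bot x hx, bot_inf_eq, Subgroup.bot_prod_bot]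
  inertia_equiv_zHat x hx := (X.inertia_equiv_zHat x hx).map fun e => (X.inertiaProdEquiv A x).trans e

/-- The tempered group of the product curve datum. [cite: MochizukiSemiAnbd2006, §6 p.69] -/
theorem prodDiscrete_piTemp : (X.prodDiscrete A).PiTemp = (X.PiTemp × A) := rfl

/-- `Δ^tp` of the product datum is `Δ^tp × A`. [cite: MochizukiSemiAnbd2006, §6 p.69] -/
theorem deltaTemp_prodDiscrete : (X.prodDiscrete A).DeltaTemp = X.DeltaTemp.prod ⊤ :=
  ker_comp_fst X.aug.toMonoidHom

/-- **`Δ` of the product datum is `Δ × A`** (closure of `Δ^tp × A` in `Π × A`).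
[cite: MochizukiSemiAnbd2006, §6 p.69] -/
theorem deltaHat_prodDiscrete : (X.prodDiscrete A).DeltaHat = X.DeltaHat.prod ⊤ := by
  show ((X.prodDiscrete A).DeltaTemp.map
      (X.toHat.toMonoidHom.prodMap (MonoidHom.id A))).topologicalClosure = _
  rw [deltaTemp_prodDiscrete, map_prodMap_prod, Subgroup.map_id, topologicalClosure_prod_top]
  rfl

end TemperedCurve

end Literature.AnabelianGeometry.SemiGraphs


namespace Literature.AnabelianGeometry.EtaleTheta

open Literature.AnabelianGeometry.SemiGraphs Literature.AnabelianGeometry.SemiGraphs.ProdDiscrete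

/-- In a commutative group every commutator subgroup is trivial. (bookkeeping for the product datum `Π^tp × A`). [cite: MochizukiSemiAnbd2006, §6 p.69] -/
theorem ThetaSetting.commutator_eq_bot_of_comm {C : Type*} [CommGroup C] (H K : Subgroup C) : ⁅H, K⁆ = ⊥ := by
  rw [Subgroup.commutator_eq_bot_iff_le_centralizer]
  intro x _ y _
  exact mul_comm y x

namespace ThetaSetting

variable {p : ℕ} [Fact p.Prime] (D : ThetaSetting p) (A : Type) [CommGroup A] [Finite A] [TopologicalSpace A]
  [DiscreteTopology A]

omit [Finite A] in
/-- The iterated commutator closures of `Δ_X × A` pulled back to `Π^tp_X × A` are those of `Δ_X`, times `1`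
(`A` abelian and Hausdorff). [cite: MochizukiEtTh2009, §1 p.12] -/
theorem comap_closure_commutator_prod (C : Subgroup D.PiHat) :
    ((C.prod (⊥ : Subgroup A)).topologicalClosure).comap (D.toHat.toMonoidHom.prodMap (MonoidHom.id A)) =
      (C.topologicalClosure.comap D.toHat.toMonoidHom).prod ⊥ := by
  rw [topologicalClosure_prod_bot, MonoidHom.prodMap_comap_prod, Subgroup.comap_id]

/-- **`D ↦ D × A` on the [EtTh] §1 root interface** (`A` finite discrete abelian): `Π^tp_X × A` over the product
tempered-curve datum, same `q_X`, `q̈`; `Π^tp_X ↠ Z` through the first projection; `(Π^tp_X)^Θ × A`,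
`(Π^tp_X)^ell × A` with the product quotient maps (the printed kernel conditions transfer because the commutator
closures of `Δ_X × A` are those of `Δ_X` times `1`); `Π^tp_{Y_N} × A`, `Π^tp_{Z_N} × A` (indices inside
`Δ^tp_X × A` unchanged). A synthetic closure property of the typed interface — not a curve.
[cite: MochizukiEtTh2009, §1 p.12] -/
abbrev prodDiscrete : ThetaSetting p where
  toTemperedCurve := D.toTemperedCurve.prodDiscrete A
  qX := D.qX
  qX_mem := D.qX_mem
  norm_qX_lt_one := D.norm_qX_lt_one
  qX_ne_zero := D.qX_ne_zero
  sqrtqX := D.sqrtqX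
  sqrtqX_sq := D.sqrtqX_sq
  toZ := D.toZ.comp (MonoidHom.fst D.PiTemp A)
  toZ_surjective z := by
    obtain ⟨g, hg⟩ := D.toZ_surjective z
    exact ⟨(g, 1), hg⟩
  isOpen_ker_toZ := by
    rw [ker_comp_fst, Subgroup.coe_prod, Subgroup.coe_top]
    exact D.isOpen_ker_toZ.prod isOpen_univ
  toZ_delta_surjective z := by
    obtain ⟨⟨g, hg⟩, e⟩ := D.toZ_delta_surjective z
    exact ⟨⟨(g, 1), hg⟩, e⟩
  GtpTheta := D.GtpTheta × A
  toTheta := D.toTheta.prodMap (MonoidHom.id A)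
  continuous_toTheta := D.continuous_toTheta.prodMap continuous_id
  toTheta_surjective := D.toTheta_surjective.prodMap Function.surjective_id
  ker_toTheta := by
    show _ = Subgroup.comap (D.toHat.toMonoidHom.prodMap (MonoidHom.id A)) _
    rw [MonoidHom.ker_prodMap, MonoidHom.ker_id, D.ker_toTheta, TemperedCurve.deltaHat_prodDiscrete,
      Subgroup.commutator_prod_prod, Subgroup.commutator_prod_prod,
      commutator_eq_bot_of_comm ⁅(⊤ : Subgroup A), ⊤⁆ ⊤, comap_closure_commutator_prod]
  GtpEll := D.GtpEll × A
  thetaToEll := D.thetaToEll.prodMap (MonoidHom.id A)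
  continuous_thetaToEll := D.continuous_thetaToEll.prodMap continuous_id
  thetaToEll_surjective := D.thetaToEll_surjective.prodMap Function.surjective_id
  ker_toEll := by
    have hc : (D.thetaToEll.prodMap (MonoidHom.id A)).comp (D.toTheta.prodMap (MonoidHom.id A)) =
        (D.thetaToEll.comp D.toTheta).prodMap (MonoidHom.id A) :=
      MonoidHom.ext fun _ => rfl
    show _ = Subgroup.comap (D.toHat.toMonoidHom.prodMap (MonoidHom.id A)) _
    rw [hc, MonoidHom.ker_prodMap, MonoidHom.ker_id, D.ker_toEll, TemperedCurve.deltaHat_prodDiscrete,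
      Subgroup.commutator_prod_prod, commutator_eq_bot_of_comm (⊤ : Subgroup A) ⊤,
      comap_closure_commutator_prod]
  ker_thetaToEll_comm x hx y hy := by
    rw [MonoidHom.ker_prodMap, Subgroup.mem_prod] at hx hy
    exact Prod.ext (D.ker_thetaToEll_comm x.1 hx.1 y.1 hy.1) (mul_comm _ _)
  ker_thetaToEll_central x hx y hy := by
    rw [MonoidHom.ker_prodMap, Subgroup.mem_prod] at hx
    have hy' : y ∈ ((D.aug.toMonoidHom.comp (MonoidHom.fst D.PiTemp A)).ker).map
        (D.toTheta.prodMap (MonoidHom.id A)) := hy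
    rw [ker_comp_fst, map_prodMap_prod, Subgroup.mem_prod] at hy'
    exact Prod.ext (D.ker_thetaToEll_central x.1 hx.1 y.1 hy'.1) (mul_comm _ _)
  GtpYN N := (D.GtpYN N).prod ⊤
  GtpYN_one := by
    rw [D.GtpYN_one]
    exact (ker_comp_fst D.toZ).symm
  GtpYN_le N := by
    rw [ker_comp_fst]
    exact Subgroup.prod_mono (D.GtpYN_le N) le_rfl
  map_aug_GtpYN N := by
    show ((D.GtpYN N).prod (⊤ : Subgroup A)).map (D.aug.toMonoidHom.comp (MonoidHom.fst D.PiTemp A)) = _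
    rw [map_comp_fst_prod]
    exact D.map_aug_GtpYN N
  GtpYN_normal N := by
    haveI := D.GtpYN_normal N
    exact Subgroup.prod_normal _ _
  isOpen_GtpYN N := by
    rw [Subgroup.coe_prod, Subgroup.coe_top]
    exact (D.isOpen_GtpYN N).prod isOpen_univ
  GtpYN_anti M N h := Subgroup.prod_mono (D.GtpYN_anti M N h) le_rfl
  relIndex_deltaYN N := by
    show ((D.GtpYN N).prod (⊤ : Subgroup A) ⊓ (D.aug.toMonoidHom.comp (MonoidHom.fst D.PiTemp A)).ker).relIndex
        ((D.toZ.comp (MonoidHom.fst D.PiTemp A)).ker ⊓ (D.aug.toMonoidHom.comp (MonoidHom.fst D.PiTemp A)).ker) = N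
    rw [ker_comp_fst, ker_comp_fst, prod_inf_prod, prod_inf_prod, inf_idem, relIndex_prod_top]
    exact D.relIndex_deltaYN N
  GtpZN N := (D.GtpZN N).prod ⊤
  GtpZN_le N := Subgroup.prod_mono (D.GtpZN_le N) le_rfl
  map_aug_GtpZN N := by
    show ((D.GtpZN N).prod (⊤ : Subgroup A)).map (D.aug.toMonoidHom.comp (MonoidHom.fst D.PiTemp A)) = _
    rw [map_comp_fst_prod]
    exact D.map_aug_GtpZN N
  GtpZN_normal N := by
    haveI := D.GtpZN_normal N
    exact Subgroup.prod_normal _ _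
  isOpen_GtpZN N := by
    rw [Subgroup.coe_prod, Subgroup.coe_top]
    exact (D.isOpen_GtpZN N).prod isOpen_univ
  GtpZN_anti M N h := Subgroup.prod_mono (D.GtpZN_anti M N h) le_rfl
  relIndex_deltaZN N := by
    show ((D.GtpZN N).prod (⊤ : Subgroup A) ⊓ (D.aug.toMonoidHom.comp (MonoidHom.fst D.PiTemp A)).ker).relIndex
        ((D.GtpYN N).prod (⊤ : Subgroup A) ⊓ (D.aug.toMonoidHom.comp (MonoidHom.fst D.PiTemp A)).ker) = N
    rw [ker_comp_fst, prod_inf_prod, prod_inf_prod, inf_idem, relIndex_prod_top]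
    exact D.relIndex_deltaZN N
  ker_toTheta_le_GtpZN N := by
    rw [MonoidHom.ker_prodMap, MonoidHom.ker_id, prod_inf_prod]
    exact Subgroup.prod_mono (D.ker_toTheta_le_GtpZN N) le_top

/-- The tempered group of `D × A` is `Π^tp_X × A`. [cite: MochizukiEtTh2009, §1 p.12] -/
theorem prodDiscrete_gtp : (D.prodDiscrete A).Gtp = (D.PiTemp × A) := rfl

/-- **`Δ_X` of `D × A` is `Δ_X × A`.** [cite: MochizukiEtTh2009, §1 p.12] -/
theorem deltaHat_prodDiscrete : (D.prodDiscrete A).DeltaHat = D.DeltaHat.prod ⊤ :=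
  TemperedCurve.deltaHat_prodDiscrete D.toTemperedCurve A

/-- `Δ_Θ` of `D × A` is `Δ_Θ × 1`. [cite: MochizukiEtTh2009, §1 p.12] -/
theorem deltaTheta_prodDiscrete : (D.prodDiscrete A).DeltaTheta = D.DeltaTheta.prod ⊥ := by
  show (D.thetaToEll.prodMap (MonoidHom.id A)).ker = _
  rw [MonoidHom.ker_prodMap, MonoidHom.ker_id]
  rfl

end ThetaSetting

end Literature.AnabelianGeometry.EtaleTheta

end
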